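/-
Origin: written from primary sources — Y. Liu, *Fourier–Jacobi cycles and arithmetic relative trace formula*, Camb. J.
Math. 9 (2021), proof of Thm. 4.15 (arXiv:2102.11518, `FJcycle.tex` l. 2193–2210: for an orthogonal decomposition
`V = V⋆ ⊕ V⋆^⊥` the restriction of the Weil representation of `U(V)` to `U(V⋆) × U(V⋆^⊥)` is the exterior tensor product
of the two small Weil representations, so theta functions restrict to products of theta functions); R. Howe,
*θ-series and invariant theory*, Proc. Sympos. Pure Math. 33.1 (1979) §2–§3 (the restriction is the tensor product
up to a character; renormalising the small representations makes it exact); S. Kudla, *Seesaw dual reductive pairs*,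
Progr. Math. 46 (1984) §1; S. Gelbart, J. Rogawski, Invent. Math. 105 (1991) §3.1 Prop. 3.1.1 p. 455, Remark p. 457
(compatible splittings; two splittings differ by a character trivial on rational points); A. Weil, Acta Math. 111
(1964) Chap. III n° 39 p. 189, n° 41 Thm 6 p. 193.  Adapted: no.  This file INSTANTIATES the product-group API of
`Weil1964/AdelicMetaplecticSeesawCharacter` and `Weil1964/AdelicMetaplecticSeesawRenormalisation` (scheme (small):
twist the small PAIR SPLITTINGS by the see-saw factor characters) at the V-side splitting data of record of
`UnitaryDualPairSeesawCharacterLeft` — the mirror image of `UnitaryDualPairSeesawSchemeSmall` with the FIRST member of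
the dual pair split.  Kernel only; no records; the compatibility of the three splittings ([GelbartRogawski1991,
Prop. 3.1.1]) is a hypothesis, never asserted.
-/
import Literature.NumberTheory.GelbartRogawski1991.UnitaryDualPairSeesawCharacterLeft
import Literature.NumberTheory.GelbartRogawski1991.UnitaryDualPairSeesawSchemeSmall
import Literature.NumberTheory.Weil1964.AdelicMetaplecticSeesawRenormalisation
import HarnessLib

/-!
# Scheme (small) on the V-side see-saw `(U(V₁) × U(V₂), U(W))`: the renormalised small PAIR SPLITTINGS, against
# which the big Weil representation restricts ON THE NOSE

Setting (`UnitaryDualPairSeesawCharacterLeft`, A. Weil / Gelbart–Rogawski data of record): a quadratic extension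
`E/F` of number fields, `c`, `δ`; hermitian Gram matrices `J₁ = T₁ ⊗ 1`, `J₂ = T₂ ⊗ 1` of the two summands of the
FIRST member `V = V₁ ⊕ V₂` (Gram `J₁ ⊕ᶠ J₂` on `Fin (N₁ + N₂)`) and `J_W = T_W ⊗ 1` of the fixed second member `W`;
enumerations `e_V : Fin (N₁ + N₂) × Fin M ≃ Fin n`, `e_j : Fin N_j × Fin M ≃ Fin n_j`; and three splittings
`s, s₁, s₂` of the dual pairs `(U(J₁ ⊕ᶠ J₂), U(J_W))`, `(U(J₁), U(J_W))`, `(U(J₂), U(J_W))`, COMPATIBLE in the sense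
of [GelbartRogawski1991, Prop. 3.1.1] (`hs`, `hs₁`, `hs₂`).  [Liu2021]'s notation: `V⋆ = V₁`, `V⋆^⊥ = V₂`,
`W = W_e` (a skew-hermitian line; here any rank `M`).

Conventions.  The product-group API of `AdelicMetaplecticSeesawCharacter` wants the COMMON member of the see-saw
first: the see-saw group is read as `U(J_W)(𝔸) × (U(J₁)(𝔸) × U(J₂)(𝔸))`, points `(u, (g₁, g₂))`, and the small pair
groups as `U(J_W)(𝔸) × U(J_j)(𝔸)`, points `(u, g_j)` — the swap of the tree's pair order `(g_j, u)` is the only price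
(`MulEquiv.prodComm`).  The small pair splittings read back along `e_j` are the tree's GENERIC
`UnitaryDualPair.pairSmall₁ F E c N₁ M e₁ J₁ J_W s₁` / `pairSmall₂ F E c N₂ M e₂ J₂ J_W s₂` of
`UnitaryDualPairSeesawSchemeSmall` (they only read a pair splitting in Kronecker coordinates and are not W-specific).

* §1 `seesawBigLeftSum s : U(J_W)(𝔸) × (U(J₁)(𝔸) × U(J₂)(𝔸)) →* Mp_ψ(W_{(T₁ ⊗ T_W ⊗ 1) ⊕ (T₂ ⊗ T_W ⊗ 1)})ᶜᵒⁿᵗ` — the big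
  pair splitting `s_pair(g₁ ⊕ᶠ g₂, u)` in BLOCK-SUM coordinates `(Fin N₁ × Fin M) ⊕ (Fin N₂ × Fin M)`
  (`sumSeesawSplitting` along `e_Σ = (finSumFinEquiv × 1)⁻¹ ≫ Equiv.sumProdDistrib` of `seesawBigLeft s`);
  `pairSmallLeft₁ s₁ : U(J_W)(𝔸) × U(J₁)(𝔸) →* Mp_ψ(W_{T₁ ⊗ T_W ⊗ 1})ᶜᵒⁿᵗ`, `(u, g₁) ↦ pairSmall₁ s₁ (g₁, u)`, and
  `pairSmallLeft₂ s₂`; continuity; the see-saw hypothesis in product shape (**`hs₃_seesawLeft`**);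
* §2 the FACTOR CHARACTERS of the V-side see-saw character: **`charW : U(J_W)(𝔸) →* ℂˣ`** (`u ↦ χ(u,(1,1))`),
  **`charLeft₁ : U(J₁)(𝔸) →* ℂˣ`**, **`charLeft₂ : U(J₂)(𝔸) →* ℂˣ`** — trivial on rational points
  (`charW_eq_one_of_rational`, …: they are AUTOMORPHIC characters), continuous along continuous pair splittings
  (`continuous_charW`, …); these ARE «the see-saw characters on `U(V⋆) × U(V⋆^⊥)`» of [Liu2021]'s restriction for the
  splittings of record (step S2c of the cell's LIU415 plan); the scheme-(small) characters are
  `c₁(u,g₁) = charW u · charLeft₁ g₁` and `c₂(u,g₂) = charLeft₂ g₂` (`mpCharSmall₁_seesawLeft_apply`, `mpCharSmall₂_seesawLeft_apply`);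
* §3 **the renormalised small pair splittings** `pairSmallLeft₁ s₁ ⊗ c₁`, `pairSmallLeft₂ s₂ ⊗ c₂`
  (`adelicMpCont.twist`; spelled out, no definition): **`restrictTmulLeft`** — for ALL `u, g₁, g₂, Φ₁, Φ₂`,
  `ω(seesawBigLeftSum s (u,(g₁,g₂))) (Φ₁ ⊠ Φ₂) = ω((pairSmallLeft₁ s₁ ⊗ c₁)(u,g₁)) Φ₁ ⊠ ω((pairSmallLeft₂ s₂ ⊗ c₂)(u,g₂)) Φ₂`
  («the restriction of `ω_{μ,ε}` to `U(V⋆) × U(V⋆^⊥)` is `ω⋆ ⊠ ω⋆^⊥`», ON THE NOSE, as a statement about SPLITTINGS);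
  **`mpSeesawChar₃_twistLeft_eq_one`** — against the renormalised pair the see-saw character is IDENTICALLY `1`;
  **`thetaDistLM_omega_seesawBigLeftSum_eq_mul_twist`** — `Θ(ω(seesawBigLeftSum s (u,(g₁,g₂))) (Φ₁ ⊠ Φ₂)) =
  Θ(ω((pairSmallLeft₁ s₁ ⊗ c₁)(u,g₁)) Φ₁) · Θ(ω((pairSmallLeft₂ s₂ ⊗ c₂)(u,g₂)) Φ₂)` with NO character left over, and
  its read-back **`thetaDistLM_pairSplitting_blockDiag_eq_mul_twist`** to the big pair splitting of record
  `s_pair(g₁ ⊕ᶠ g₂, u)` and the test function `R_{e_V} R_{e_Σ}⁻¹ (Φ₁ ⊠ Φ₂)` ([Liu2021] display l. 2204–2208 for ALL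
  adelic arguments, not only rational ones — compare `thetaDistLM_omega_seesawBigLeft_sumTensor_rational` of
  `UnitaryDualPairSeesawCharacterLeft`, which keeps the splittings of record and drops the character at rational
  arguments only);
* §4 **the renormalised small pair splittings are as good as the original ones for theta series**: they lie over the
  same symplectic maps (`proj_twist_pairSmallLeft₁/₂`), agree with `pairSmallLeft_j s_j` at rational points and are
  `Θ`-fixing there (`twist_pairSmallLeft₁/₂_apply_of_rational`, `coe_twist_pairSmallLeft₁/₂_mem_adelicMpTheta` —
  the input `hrat` of `Weil1964.ThetaKernelDatum.adelicOfDualPair`), and are continuous along continuous pair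
  splittings (`continuous_twist_pairSmallLeft₁/₂`); the RESIDUAL FREEDOM — any other such pair differs by
  `(ν ∘ pr_W, ν⁻¹ ∘ pr_W)` for ONE character `ν` of `U(J_W)(𝔸)` — is `Weil1964.exists_eq_twist_fst_of_omega_apply_tensorToSum_eq`
  applied verbatim (not restated).

Provenance / use: cell `hodgecm-mathlib`, programme T2 = [Liu2021, Thm. 4.15] (row III-9′), step S2c of
`A-plan/LIU415-SPEC.md` (banked Literature theorems toward the later split of the (S) stub of `Lines/a3_liu418.lean`;
no floor change): with S2a (`UnitaryGroupDirectSumCarriersLeft`, `UnitaryDualPairSeesawCharacterLeft`) this is the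
kernel form of Liu's «claim» for pure tensors, in the shape in which the small theta spaces `V⋆(μ,e)` can be DEFINED
(through `pairSmallLeft_j s_j ⊗ c_j`) so that «`res V(μ,e) ⊆ V⋆(μ,e) ⊗ 𝒞([U(V⋆^⊥)])`» holds literally; S2d (finite sums
of pure tensors for the cell's test vectors) and S2e (functionals → forms) are separate files.

DEFINITIONS (def lane): `seesawBigLeftSum`, `pairSmallLeft₁`, `pairSmallLeft₂`, `charW`, `charLeft₁`, `charLeft₂`
(the V-side twins of `seesawBigSum`, `pairSmall₁/₂`-on-the-see-saw, `charV₁₂`, `char₁`, `char₂` of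
`UnitaryDualPairSeesawSchemeSmall`); everything else is a theorem; no named fact, no instance, no `sorry`.
-/

set_option autoImplicit false

noncomputable section

open scoped Matrix Kronecker
open NumberField
open Literature.RepresentationTheory Literature.RepresentationTheory.SeesawScalar
open Literature.RepresentationTheory.HeisenbergGroup
open Literature.NumberTheory.Automorphic
open Literature.NumberTheory.Automorphic.UnitaryGroup
open Literature.NumberTheory.Weil1964

namespace Literature.NumberTheory.GelbartRogawski1991

namespace UnitaryDualPair

/-! ## §1 The homomorphisms in the product shape `U(J_W)(𝔸) × (U(J₁)(𝔸) × U(J₂)(𝔸))` -/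

section Homs

variable (F E : Type) [Field F] [NumberField F] [Field E] [NumberField E] [Algebra F E]
variable (c : E ≃ₐ[F] E) (N₁ N₂ M : ℕ) {n n₁ n₂ : ℕ}
  (eV : Fin (N₁ + N₂) × Fin M ≃ Fin n) (e₁ : Fin N₁ × Fin M ≃ Fin n₁) (e₂ : Fin N₂ × Fin M ≃ Fin n₂)
variable (J₁ : Matrix (Fin N₁) (Fin N₁) E) (J₂ : Matrix (Fin N₂) (Fin N₂) E) (JW : Matrix (Fin M) (Fin M) E)
variable {T₁ : Matrix (Fin N₁) (Fin N₁) F} {T₂ : Matrix (Fin N₂) (Fin N₂) F} {TW : Matrix (Fin M) (Fin M) F}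

/-- **the big pair splitting of the V-side see-saw in BLOCK-SUM coordinates** `(Fin N₁ × Fin M) ⊕ (Fin N₂ × Fin M)`
(Gram `(T₁ ⊗ T_W ⊗ 1) ⊕ (T₂ ⊗ T_W ⊗ 1)`), on `U(J_W)(𝔸) × (U(J₁)(𝔸) × U(J₂)(𝔸))`:
`(u, (g₁, g₂)) ↦ sumTransport_{e_Σ} (seesawBigLeft s ((g₁, g₂), u))`. [cite: Kudla1984, §1] -/
def seesawBigLeftSum (s : adelicPair F E c (N₁ + N₂) M (finSum N₁ N₂ J₁ J₂) JW →*
      adelicMpCont F (Fin n) (adelicGram F eV (finSum N₁ N₂ T₁ T₂) TW)) :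
    adelic F E c M JW × (adelic F E c N₁ J₁ × adelic F E c N₂ J₂) →*
      adelicMpCont F ((Fin N₁ × Fin M) ⊕ (Fin N₂ × Fin M))
        (Matrix.fromBlocks (T₁.map (algebraMap F (AdeleRing (𝓞 F) F)) ⊗ₖ TW.map (algebraMap F (AdeleRing (𝓞 F) F))) 0 0
          (T₂.map (algebraMap F (AdeleRing (𝓞 F) F)) ⊗ₖ TW.map (algebraMap F (AdeleRing (𝓞 F) F)))) :=
  (sumSeesawSplitting ((finSumFinEquiv.prodCongr (Equiv.refl (Fin M))).symm.trans
        (Equiv.sumProdDistrib (Fin N₁) (Fin N₂) (Fin M))) (reindex_gram_finSum_left F N₁ N₂ M)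
      (seesawBigLeft F E c N₁ N₂ M eV J₁ J₂ JW s)).comp
    (MulEquiv.prodComm : adelic F E c M JW × (adelic F E c N₁ J₁ × adelic F E c N₂ J₂) ≃*
        (adelic F E c N₁ J₁ × adelic F E c N₂ J₂) × adelic F E c M JW).toMonoidHom

/-- Unfolding: `seesawBigLeftSum s (u,(g₁,g₂)) = sumSeesawSplitting e_Σ _ (seesawBigLeft s) ((g₁,g₂),u)`. [cite: Kudla1984, §1] -/
theorem seesawBigLeftSum_apply (s : adelicPair F E c (N₁ + N₂) M (finSum N₁ N₂ J₁ J₂) JW →*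
      adelicMpCont F (Fin n) (adelicGram F eV (finSum N₁ N₂ T₁ T₂) TW))
    (u : adelic F E c M JW) (g₁ : adelic F E c N₁ J₁) (g₂ : adelic F E c N₂ J₂) :
    seesawBigLeftSum F E c N₁ N₂ M eV J₁ J₂ JW s (u, (g₁, g₂)) =
      sumSeesawSplitting ((finSumFinEquiv.prodCongr (Equiv.refl (Fin M))).symm.trans
          (Equiv.sumProdDistrib (Fin N₁) (Fin N₂) (Fin M))) (reindex_gram_finSum_left F N₁ N₂ M)
        (seesawBigLeft F E c N₁ N₂ M eV J₁ J₂ JW s) ((g₁, g₂), u) :=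
  rfl

/-- **the first small pair splitting on `U(J_W)(𝔸) × U(J₁)(𝔸)`**, Kronecker coordinates:
`(u, g₁) ↦ pairSmall₁ s₁ (g₁, u) = reindex_{e₁}⁻¹ (s_{1,pair}(g₁, u))`. [cite: Kudla1984, §1] -/
def pairSmallLeft₁ (s₁ : adelicPair F E c N₁ M J₁ JW →* adelicMpCont F (Fin n₁) (adelicGram F e₁ T₁ TW)) :
    adelic F E c M JW × adelic F E c N₁ J₁ →*
      adelicMpCont F (Fin N₁ × Fin M)
        (T₁.map (algebraMap F (AdeleRing (𝓞 F) F)) ⊗ₖ TW.map (algebraMap F (AdeleRing (𝓞 F) F))) :=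
  (pairSmall₁ F E c N₁ M e₁ J₁ JW s₁).comp
    (MulEquiv.prodComm : adelic F E c M JW × adelic F E c N₁ J₁ ≃* adelic F E c N₁ J₁ × adelic F E c M JW).toMonoidHom

/-- **the second small pair splitting on `U(J_W)(𝔸) × U(J₂)(𝔸)`**, Kronecker coordinates:
`(u, g₂) ↦ pairSmall₂ s₂ (g₂, u)`. [cite: Kudla1984, §1] -/
def pairSmallLeft₂ (s₂ : adelicPair F E c N₂ M J₂ JW →* adelicMpCont F (Fin n₂) (adelicGram F e₂ T₂ TW)) :
    adelic F E c M JW × adelic F E c N₂ J₂ →*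
      adelicMpCont F (Fin N₂ × Fin M)
        (T₂.map (algebraMap F (AdeleRing (𝓞 F) F)) ⊗ₖ TW.map (algebraMap F (AdeleRing (𝓞 F) F))) :=
  (pairSmall₂ F E c N₂ M e₂ J₂ JW s₂).comp
    (MulEquiv.prodComm : adelic F E c M JW × adelic F E c N₂ J₂ ≃* adelic F E c N₂ J₂ × adelic F E c M JW).toMonoidHom

/-- Unfolding: `pairSmallLeft₁ s₁ (u, g₁) = pairSmall₁ s₁ (g₁, u)`. [cite: Kudla1984, §1] -/
theorem pairSmallLeft₁_apply (s₁ : adelicPair F E c N₁ M J₁ JW →* adelicMpCont F (Fin n₁) (adelicGram F e₁ T₁ TW))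
    (u : adelic F E c M JW) (g₁ : adelic F E c N₁ J₁) :
    pairSmallLeft₁ F E c N₁ M e₁ J₁ JW s₁ (u, g₁) = pairSmall₁ F E c N₁ M e₁ J₁ JW s₁ (g₁, u) :=
  rfl

/-- Unfolding: `pairSmallLeft₂ s₂ (u, g₂) = pairSmall₂ s₂ (g₂, u)`. [cite: Kudla1984, §1] -/
theorem pairSmallLeft₂_apply (s₂ : adelicPair F E c N₂ M J₂ JW →* adelicMpCont F (Fin n₂) (adelicGram F e₂ T₂ TW))
    (u : adelic F E c M JW) (g₂ : adelic F E c N₂ J₂) :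
    pairSmallLeft₂ F E c N₂ M e₂ J₂ JW s₂ (u, g₂) = pairSmall₂ F E c N₂ M e₂ J₂ JW s₂ (g₂, u) :=
  rfl

/-- `seesawSmallLeft₁ s₁ ((g₁,g₂),u) = pairSmallLeft₁ s₁ (u, g₁)` (both are `reindex_{e₁}⁻¹ (s_{1,pair}(g₁,u))`).
[cite: Kudla1984, §1] -/
theorem seesawSmallLeft₁_apply_eq (s₁ : adelicPair F E c N₁ M J₁ JW →* adelicMpCont F (Fin n₁) (adelicGram F e₁ T₁ TW))
    (u : adelic F E c M JW) (g₁ : adelic F E c N₁ J₁) (g₂ : adelic F E c N₂ J₂) :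
    seesawSmallLeft₁ F E c N₁ N₂ M e₁ J₁ J₂ JW s₁ ((g₁, g₂), u) = pairSmallLeft₁ F E c N₁ M e₁ J₁ JW s₁ (u, g₁) :=
  rfl

/-- `seesawSmallLeft₂ s₂ ((g₁,g₂),u) = pairSmallLeft₂ s₂ (u, g₂)`. [cite: Kudla1984, §1] -/
theorem seesawSmallLeft₂_apply_eq (s₂ : adelicPair F E c N₂ M J₂ JW →* adelicMpCont F (Fin n₂) (adelicGram F e₂ T₂ TW))
    (u : adelic F E c M JW) (g₁ : adelic F E c N₁ J₁) (g₂ : adelic F E c N₂ J₂) :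
    seesawSmallLeft₂ F E c N₁ N₂ M e₂ J₁ J₂ JW s₂ ((g₁, g₂), u) = pairSmallLeft₂ F E c N₂ M e₂ J₂ JW s₂ (u, g₂) :=
  rfl

/-- continuity of `pairSmallLeft₁ s₁` along a continuous pair splitting. [cite: GelbartRogawski1991, §3.1 Prop. 3.1.1 p. 455] -/
theorem continuous_pairSmallLeft₁ {s₁ : adelicPair F E c N₁ M J₁ JW →* adelicMpCont F (Fin n₁) (adelicGram F e₁ T₁ TW)}
    (hc₁ : Continuous (pairSplitting F E c N₁ M e₁ J₁ JW s₁)) :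
    Continuous (pairSmallLeft₁ F E c N₁ M e₁ J₁ JW s₁) :=
  (continuous_pairSmall₁ F E c N₁ M e₁ J₁ JW hc₁).comp continuous_swap

/-- continuity of `pairSmallLeft₂ s₂` along a continuous pair splitting. [cite: GelbartRogawski1991, §3.1 Prop. 3.1.1 p. 455] -/
theorem continuous_pairSmallLeft₂ {s₂ : adelicPair F E c N₂ M J₂ JW →* adelicMpCont F (Fin n₂) (adelicGram F e₂ T₂ TW)}
    (hc₂ : Continuous (pairSplitting F E c N₂ M e₂ J₂ JW s₂)) :
    Continuous (pairSmallLeft₂ F E c N₂ M e₂ J₂ JW s₂) :=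
  (continuous_pairSmall₂ F E c N₂ M e₂ J₂ JW hc₂).comp continuous_swap

/-- continuity of `seesawBigLeftSum s` along a continuous big pair splitting. [cite: GelbartRogawski1991, §3.1 Prop. 3.1.1 p. 455] -/
theorem continuous_seesawBigLeftSum {s : adelicPair F E c (N₁ + N₂) M (finSum N₁ N₂ J₁ J₂) JW →*
      adelicMpCont F (Fin n) (adelicGram F eV (finSum N₁ N₂ T₁ T₂) TW)}
    (hc : Continuous (pairSplitting F E c (N₁ + N₂) M eV (finSum N₁ N₂ J₁ J₂) JW s)) :
    Continuous (seesawBigLeftSum F E c N₁ N₂ M eV J₁ J₂ JW s) :=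
  (continuous_sumSeesawSplitting ((finSumFinEquiv.prodCongr (Equiv.refl (Fin M))).symm.trans
        (Equiv.sumProdDistrib (Fin N₁) (Fin N₂) (Fin M))) (reindex_gram_finSum_left F N₁ N₂ M) _
      (continuous_seesawBigLeft F E c N₁ N₂ M eV J₁ J₂ JW hc (continuous_adelicMpContReindex_symm F eV _))).comp
    continuous_swap

end Homs

/-! ## §2–§4 At compatible splittings: the characters, `RestrictTmul` on the nose, rational points -/

section Compatible

variable (F E : Type) [Field F] [NumberField F] [Field E] [NumberField E] [Algebra F E]
variable (c : E ≃ₐ[F] E) (N₁ N₂ M : ℕ) {n n₁ n₂ : ℕ}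
  (eV : Fin (N₁ + N₂) × Fin M ≃ Fin n) (e₁ : Fin N₁ × Fin M ≃ Fin n₁) (e₂ : Fin N₂ × Fin M ≃ Fin n₂)
variable (J₁ : Matrix (Fin N₁) (Fin N₁) E) (J₂ : Matrix (Fin N₂) (Fin N₂) E) (JW : Matrix (Fin M) (Fin M) E)
variable {T₁ : Matrix (Fin N₁) (Fin N₁) F} {T₂ : Matrix (Fin N₂) (Fin N₂) F} {TW : Matrix (Fin M) (Fin M) F}
variable [Algebra.IsQuadraticExtension F E] {δ : E} (hcδ : c δ = -δ) (hδ : δ ≠ 0) {d : F}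
  (hd : δ * δ = algebraMap F E d) (h₁ : T₁.IsSymm) (h₂ : T₂.IsSymm) (hW : TW.IsSymm) (h₁d : IsUnit T₁.det)
  (h₂d : IsUnit T₂.det) (hWd : IsUnit TW.det) (hVd : IsUnit (finSum N₁ N₂ T₁ T₂).det)
  (hJ₁ : J₁ = T₁.map (algebraMap F E)) (hJ₂ : J₂ = T₂.map (algebraMap F E)) (hJW : JW = TW.map (algebraMap F E))
  {s : adelicPair F E c (N₁ + N₂) M (finSum N₁ N₂ J₁ J₂) JW →*
    adelicMpCont F (Fin n) (adelicGram F eV (finSum N₁ N₂ T₁ T₂) TW)}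
  {s₁ : adelicPair F E c N₁ M J₁ JW →* adelicMpCont F (Fin n₁) (adelicGram F e₁ T₁ TW)}
  {s₂ : adelicPair F E c N₂ M J₂ JW →* adelicMpCont F (Fin n₂) (adelicGram F e₂ T₂ TW)}
  (hs : (splittingDatum F E c (N₁ + N₂) M eV (finSum N₁ N₂ J₁ J₂) JW hcδ hδ hd (isSymm_finSum h₁ h₂) hW hVd hWd
    (finSum_eq_map_finSum F E N₁ N₂ J₁ J₂ hJ₁ hJ₂) hJW).IsCompatible s)
  (hs₁ : (splittingDatum F E c N₁ M e₁ J₁ JW hcδ hδ hd h₁ hW h₁d hWd hJ₁ hJW).IsCompatible s₁)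
  (hs₂ : (splittingDatum F E c N₂ M e₂ J₂ JW hcδ hδ hd h₂ hW h₂d hWd hJ₂ hJW).IsCompatible s₂)

include hs hs₁ hs₂ in
/-- **the V-side see-saw hypothesis in the product shape of `AdelicMetaplecticSeesawCharacter`**:
`π(seesawBigLeftSum s (u,(g₁,g₂))) = π(pairSmallLeft₁ s₁ (u,g₁)) ⊕ π(pairSmallLeft₂ s₂ (u,g₂))`. [cite: Kudla1984, §1] -/
theorem hs₃_seesawLeft (u : adelic F E c M JW) (g₁ : adelic F E c N₁ J₁) (g₂ : adelic F E c N₂ J₂) :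
    adelicMpCont.proj F ((Fin N₁ × Fin M) ⊕ (Fin N₂ × Fin M))
        (Matrix.fromBlocks (T₁.map (algebraMap F (AdeleRing (𝓞 F) F)) ⊗ₖ TW.map (algebraMap F (AdeleRing (𝓞 F) F))) 0 0
          (T₂.map (algebraMap F (AdeleRing (𝓞 F) F)) ⊗ₖ TW.map (algebraMap F (AdeleRing (𝓞 F) F))))
        (seesawBigLeftSum F E c N₁ N₂ M eV J₁ J₂ JW s (u, (g₁, g₂))) =
      spSum (T₁.map (algebraMap F (AdeleRing (𝓞 F) F)) ⊗ₖ TW.map (algebraMap F (AdeleRing (𝓞 F) F)))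
        (T₂.map (algebraMap F (AdeleRing (𝓞 F) F)) ⊗ₖ TW.map (algebraMap F (AdeleRing (𝓞 F) F)))
        (adelicMpCont.proj F (Fin N₁ × Fin M)
            (T₁.map (algebraMap F (AdeleRing (𝓞 F) F)) ⊗ₖ TW.map (algebraMap F (AdeleRing (𝓞 F) F)))
            (pairSmallLeft₁ F E c N₁ M e₁ J₁ JW s₁ (u, g₁)),
          adelicMpCont.proj F (Fin N₂ × Fin M)
            (T₂.map (algebraMap F (AdeleRing (𝓞 F) F)) ⊗ₖ TW.map (algebraMap F (AdeleRing (𝓞 F) F)))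
            (pairSmallLeft₂ F E c N₂ M e₂ J₂ JW s₂ (u, g₂))) :=
  proj_sumSeesawSplitting ((finSumFinEquiv.prodCongr (Equiv.refl (Fin M))).symm.trans
      (Equiv.sumProdDistrib (Fin N₁) (Fin N₂) (Fin M))) (reindex_gram_finSum_left F N₁ N₂ M)
    (seesawBigLeft F E c N₁ N₂ M eV J₁ J₂ JW s) (seesawSmallLeft₁ F E c N₁ N₂ M e₁ J₁ J₂ JW s₁)
    (seesawSmallLeft₂ F E c N₁ N₂ M e₂ J₁ J₂ JW s₂)
    (hS_seesawLeft F E c N₁ N₂ M eV e₁ e₂ J₁ J₂ JW hcδ hδ hd h₁ h₂ hW h₁d h₂d hWd hVd hJ₁ hJ₂ hJW hs hs₁ hs₂)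
    ((g₁, g₂), u)

/-! ### §2 The factor characters -/

/-- **`λ_W : U(J_W)(𝔸) →* ℂˣ`, `u ↦ χ(u,(1,1))`** — the `U(J_W)`-factor of the V-side see-saw character
(`AdelicMetaplecticSeesawCharacter.mpCharV` at the data of record). [cite: Howe1979, §3] -/
def charW : adelic F E c M JW →* ℂˣ :=
  mpCharV (seesawBigLeftSum F E c N₁ N₂ M eV J₁ J₂ JW s) (pairSmallLeft₁ F E c N₁ M e₁ J₁ JW s₁)
    (pairSmallLeft₂ F E c N₂ M e₂ J₂ JW s₂)
    (hs₃_seesawLeft F E c N₁ N₂ M eV e₁ e₂ J₁ J₂ JW hcδ hδ hd h₁ h₂ hW h₁d h₂d hWd hVd hJ₁ hJ₂ hJW hs hs₁ hs₂)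
    (isUnit_kronecker_map F N₁ h₁d hWd) (isUnit_kronecker_map F N₂ h₂d hWd)

/-- **`λ₁ : U(J₁)(𝔸) →* ℂˣ`, `g₁ ↦ χ(1,(g₁,1))`** — the `U(V⋆)`-factor. [cite: Howe1979, §3] -/
def charLeft₁ : adelic F E c N₁ J₁ →* ℂˣ :=
  mpChar₁ (seesawBigLeftSum F E c N₁ N₂ M eV J₁ J₂ JW s) (pairSmallLeft₁ F E c N₁ M e₁ J₁ JW s₁)
    (pairSmallLeft₂ F E c N₂ M e₂ J₂ JW s₂)
    (hs₃_seesawLeft F E c N₁ N₂ M eV e₁ e₂ J₁ J₂ JW hcδ hδ hd h₁ h₂ hW h₁d h₂d hWd hVd hJ₁ hJ₂ hJW hs hs₁ hs₂)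
    (isUnit_kronecker_map F N₁ h₁d hWd) (isUnit_kronecker_map F N₂ h₂d hWd)

/-- **`λ₂ : U(J₂)(𝔸) →* ℂˣ`, `g₂ ↦ χ(1,(1,g₂))`** — the `U(V⋆^⊥)`-factor. [cite: Howe1979, §3] -/
def charLeft₂ : adelic F E c N₂ J₂ →* ℂˣ :=
  mpChar₂ (seesawBigLeftSum F E c N₁ N₂ M eV J₁ J₂ JW s) (pairSmallLeft₁ F E c N₁ M e₁ J₁ JW s₁)
    (pairSmallLeft₂ F E c N₂ M e₂ J₂ JW s₂)
    (hs₃_seesawLeft F E c N₁ N₂ M eV e₁ e₂ J₁ J₂ JW hcδ hδ hd h₁ h₂ hW h₁d h₂d hWd hVd hJ₁ hJ₂ hJW hs hs₁ hs₂)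
    (isUnit_kronecker_map F N₁ h₁d hWd) (isUnit_kronecker_map F N₂ h₂d hWd)

/-- the scheme-(small) character of the first small pair is `c₁(u,g₁) = λ_W u · λ₁ g₁`. [cite: Howe1979, §3] -/
theorem mpCharSmall₁_seesawLeft_apply (u : adelic F E c M JW) (g₁ : adelic F E c N₁ J₁) :
    mpCharSmall₁ (seesawBigLeftSum F E c N₁ N₂ M eV J₁ J₂ JW s) (pairSmallLeft₁ F E c N₁ M e₁ J₁ JW s₁)
        (pairSmallLeft₂ F E c N₂ M e₂ J₂ JW s₂)
        (hs₃_seesawLeft F E c N₁ N₂ M eV e₁ e₂ J₁ J₂ JW hcδ hδ hd h₁ h₂ hW h₁d h₂d hWd hVd hJ₁ hJ₂ hJW hs hs₁ hs₂)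
        (isUnit_kronecker_map F N₁ h₁d hWd) (isUnit_kronecker_map F N₂ h₂d hWd) (u, g₁) =
      charW F E c N₁ N₂ M eV e₁ e₂ J₁ J₂ JW hcδ hδ hd h₁ h₂ hW h₁d h₂d hWd hVd hJ₁ hJ₂ hJW hs hs₁ hs₂ u *
        charLeft₁ F E c N₁ N₂ M eV e₁ e₂ J₁ J₂ JW hcδ hδ hd h₁ h₂ hW h₁d h₂d hWd hVd hJ₁ hJ₂ hJW hs hs₁ hs₂ g₁ :=
  mpCharSmall₁_apply_eq_mul _ _ _
    (hs₃_seesawLeft F E c N₁ N₂ M eV e₁ e₂ J₁ J₂ JW hcδ hδ hd h₁ h₂ hW h₁d h₂d hWd hVd hJ₁ hJ₂ hJW hs hs₁ hs₂) _ _ u g₁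

/-- the scheme-(small) character of the second small pair is `c₂(u,g₂) = λ₂ g₂`. [cite: Howe1979, §3] -/
theorem mpCharSmall₂_seesawLeft_apply (u : adelic F E c M JW) (g₂ : adelic F E c N₂ J₂) :
    mpCharSmall₂ (seesawBigLeftSum F E c N₁ N₂ M eV J₁ J₂ JW s) (pairSmallLeft₁ F E c N₁ M e₁ J₁ JW s₁)
        (pairSmallLeft₂ F E c N₂ M e₂ J₂ JW s₂)
        (hs₃_seesawLeft F E c N₁ N₂ M eV e₁ e₂ J₁ J₂ JW hcδ hδ hd h₁ h₂ hW h₁d h₂d hWd hVd hJ₁ hJ₂ hJW hs hs₁ hs₂)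
        (isUnit_kronecker_map F N₁ h₁d hWd) (isUnit_kronecker_map F N₂ h₂d hWd) (u, g₂) =
      charLeft₂ F E c N₁ N₂ M eV e₁ e₂ J₁ J₂ JW hcδ hδ hd h₁ h₂ hW h₁d h₂d hWd hVd hJ₁ hJ₂ hJW hs hs₁ hs₂ g₂ :=
  rfl

/-! ### §3 `RestrictTmul` ON THE NOSE for the renormalised small pair SPLITTINGS -/

/-- **The restriction of the big Weil representation to the V-side see-saw group IS `ω(s₁′) ⊠ ω(s₂′)` for the
renormalised small pair splittings** `s₁′ := pairSmallLeft₁ s₁ ⊗ c₁`, `s₂′ := pairSmallLeft₂ s₂ ⊗ c₂`: for ALL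
`u, g₁, g₂, Φ₁, Φ₂`, `ω(seesawBigLeftSum s (u,(g₁,g₂))) (Φ₁ ⊠ Φ₂) = ω(s₁′(u,g₁)) Φ₁ ⊠ ω(s₂′(u,g₂)) Φ₂` — [Liu2021]'s
«the restriction of the Weil representation of `U(V)` to `U(V⋆) × U(V⋆^⊥)` is the exterior tensor product of the
two small ones», on the nose. [cite: Liu2021, proof of Thm. 4.15 (FJcycle.tex l. 2199–2210)] [cite: Howe1979, §3] -/
theorem restrictTmulLeft (u : adelic F E c M JW) (g₁ : adelic F E c N₁ J₁) (g₂ : adelic F E c N₂ J₂)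
    (Φ₁ : piSchwartzBruhat F (Fin N₁ × Fin M)) (Φ₂ : piSchwartzBruhat F (Fin N₂ × Fin M)) :
    adelicMpCont.omega F ((Fin N₁ × Fin M) ⊕ (Fin N₂ × Fin M))
        (Matrix.fromBlocks (T₁.map (algebraMap F (AdeleRing (𝓞 F) F)) ⊗ₖ TW.map (algebraMap F (AdeleRing (𝓞 F) F))) 0 0
          (T₂.map (algebraMap F (AdeleRing (𝓞 F) F)) ⊗ₖ TW.map (algebraMap F (AdeleRing (𝓞 F) F))))
        (seesawBigLeftSum F E c N₁ N₂ M eV J₁ J₂ JW s (u, (g₁, g₂)))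
        (tensorToSum F (Fin N₁ × Fin M) (Fin N₂ × Fin M) Φ₁ Φ₂) =
      tensorToSum F (Fin N₁ × Fin M) (Fin N₂ × Fin M)
        (adelicMpCont.omega F (Fin N₁ × Fin M)
          (T₁.map (algebraMap F (AdeleRing (𝓞 F) F)) ⊗ₖ TW.map (algebraMap F (AdeleRing (𝓞 F) F)))
          (adelicMpCont.twist F (Fin N₁ × Fin M)
            (T₁.map (algebraMap F (AdeleRing (𝓞 F) F)) ⊗ₖ TW.map (algebraMap F (AdeleRing (𝓞 F) F)))
            (pairSmallLeft₁ F E c N₁ M e₁ J₁ JW s₁)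
            (mpCharSmall₁ (seesawBigLeftSum F E c N₁ N₂ M eV J₁ J₂ JW s) (pairSmallLeft₁ F E c N₁ M e₁ J₁ JW s₁)
              (pairSmallLeft₂ F E c N₂ M e₂ J₂ JW s₂)
              (hs₃_seesawLeft F E c N₁ N₂ M eV e₁ e₂ J₁ J₂ JW hcδ hδ hd h₁ h₂ hW h₁d h₂d hWd hVd hJ₁ hJ₂ hJW hs hs₁ hs₂)
              (isUnit_kronecker_map F N₁ h₁d hWd) (isUnit_kronecker_map F N₂ h₂d hWd)) (u, g₁)) Φ₁)
        (adelicMpCont.omega F (Fin N₂ × Fin M)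
          (T₂.map (algebraMap F (AdeleRing (𝓞 F) F)) ⊗ₖ TW.map (algebraMap F (AdeleRing (𝓞 F) F)))
          (adelicMpCont.twist F (Fin N₂ × Fin M)
            (T₂.map (algebraMap F (AdeleRing (𝓞 F) F)) ⊗ₖ TW.map (algebraMap F (AdeleRing (𝓞 F) F)))
            (pairSmallLeft₂ F E c N₂ M e₂ J₂ JW s₂)
            (mpCharSmall₂ (seesawBigLeftSum F E c N₁ N₂ M eV J₁ J₂ JW s) (pairSmallLeft₁ F E c N₁ M e₁ J₁ JW s₁)
              (pairSmallLeft₂ F E c N₂ M e₂ J₂ JW s₂)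
              (hs₃_seesawLeft F E c N₁ N₂ M eV e₁ e₂ J₁ J₂ JW hcδ hδ hd h₁ h₂ hW h₁d h₂d hWd hVd hJ₁ hJ₂ hJW hs hs₁ hs₂)
              (isUnit_kronecker_map F N₁ h₁d hWd) (isUnit_kronecker_map F N₂ h₂d hWd)) (u, g₂)) Φ₂) :=
  omega_apply_tensorToSum_eq_twistSmall _ _ _
    (hs₃_seesawLeft F E c N₁ N₂ M eV e₁ e₂ J₁ J₂ JW hcδ hδ hd h₁ h₂ hW h₁d h₂d hWd hVd hJ₁ hJ₂ hJW hs hs₁ hs₂) _ _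
    u g₁ g₂ Φ₁ Φ₂

/-- **Against the renormalised small pair the V-side see-saw character is IDENTICALLY `1`** (as a homomorphism on
`U(J_W)(𝔸) × (U(J₁)(𝔸) × U(J₂)(𝔸))`, not merely on rational points). [cite: Kudla1984, §1] -/
theorem mpSeesawChar₃_twistLeft_eq_one :
    mpSeesawChar₃ (seesawBigLeftSum F E c N₁ N₂ M eV J₁ J₂ JW s)
        (adelicMpCont.twist F (Fin N₁ × Fin M)
          (T₁.map (algebraMap F (AdeleRing (𝓞 F) F)) ⊗ₖ TW.map (algebraMap F (AdeleRing (𝓞 F) F)))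
          (pairSmallLeft₁ F E c N₁ M e₁ J₁ JW s₁)
          (mpCharSmall₁ (seesawBigLeftSum F E c N₁ N₂ M eV J₁ J₂ JW s) (pairSmallLeft₁ F E c N₁ M e₁ J₁ JW s₁)
            (pairSmallLeft₂ F E c N₂ M e₂ J₂ JW s₂)
            (hs₃_seesawLeft F E c N₁ N₂ M eV e₁ e₂ J₁ J₂ JW hcδ hδ hd h₁ h₂ hW h₁d h₂d hWd hVd hJ₁ hJ₂ hJW hs hs₁ hs₂)
            (isUnit_kronecker_map F N₁ h₁d hWd) (isUnit_kronecker_map F N₂ h₂d hWd)))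
        (adelicMpCont.twist F (Fin N₂ × Fin M)
          (T₂.map (algebraMap F (AdeleRing (𝓞 F) F)) ⊗ₖ TW.map (algebraMap F (AdeleRing (𝓞 F) F)))
          (pairSmallLeft₂ F E c N₂ M e₂ J₂ JW s₂)
          (mpCharSmall₂ (seesawBigLeftSum F E c N₁ N₂ M eV J₁ J₂ JW s) (pairSmallLeft₁ F E c N₁ M e₁ J₁ JW s₁)
            (pairSmallLeft₂ F E c N₂ M e₂ J₂ JW s₂)
            (hs₃_seesawLeft F E c N₁ N₂ M eV e₁ e₂ J₁ J₂ JW hcδ hδ hd h₁ h₂ hW h₁d h₂d hWd hVd hJ₁ hJ₂ hJW hs hs₁ hs₂)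
            (isUnit_kronecker_map F N₁ h₁d hWd) (isUnit_kronecker_map F N₂ h₂d hWd)))
        (hs_twistSmall _ _ _
          (hs₃_seesawLeft F E c N₁ N₂ M eV e₁ e₂ J₁ J₂ JW hcδ hδ hd h₁ h₂ hW h₁d h₂d hWd hVd hJ₁ hJ₂ hJW hs hs₁ hs₂) _ _)
        (isUnit_kronecker_map F N₁ h₁d hWd) (isUnit_kronecker_map F N₂ h₂d hWd) =
      1 :=
  mpSeesawChar₃_twistSmall_eq_one _ _ _
    (hs₃_seesawLeft F E c N₁ N₂ M eV e₁ e₂ J₁ J₂ JW hcδ hδ hd h₁ h₂ hW h₁d h₂d hWd hVd hJ₁ hJ₂ hJW hs hs₁ hs₂) _ _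

/-- **The theta functional of the big pair at a pure tensor is the PRODUCT of the two small theta functionals of the
renormalised small pair splittings, with no character left over**: for ALL `u, g₁, g₂, Φ₁, Φ₂`,
`Θ(ω(seesawBigLeftSum s (u,(g₁,g₂))) (Φ₁ ⊠ Φ₂)) = Θ(ω(s₁′(u,g₁)) Φ₁) · Θ(ω(s₂′(u,g₂)) Φ₂)`.
[cite: Liu2021, proof of Thm. 4.15 (FJcycle.tex l. 2204–2208)] [cite: Kudla1984, §1] -/
theorem thetaDistLM_omega_seesawBigLeftSum_eq_mul_twist (u : adelic F E c M JW) (g₁ : adelic F E c N₁ J₁)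
    (g₂ : adelic F E c N₂ J₂) (Φ₁ : piSchwartzBruhat F (Fin N₁ × Fin M)) (Φ₂ : piSchwartzBruhat F (Fin N₂ × Fin M)) :
    thetaDistLM F ((Fin N₁ × Fin M) ⊕ (Fin N₂ × Fin M))
        (adelicMpCont.omega F ((Fin N₁ × Fin M) ⊕ (Fin N₂ × Fin M))
          (Matrix.fromBlocks (T₁.map (algebraMap F (AdeleRing (𝓞 F) F)) ⊗ₖ TW.map (algebraMap F (AdeleRing (𝓞 F) F))) 0 0
            (T₂.map (algebraMap F (AdeleRing (𝓞 F) F)) ⊗ₖ TW.map (algebraMap F (AdeleRing (𝓞 F) F))))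
          (seesawBigLeftSum F E c N₁ N₂ M eV J₁ J₂ JW s (u, (g₁, g₂)))
          (tensorToSum F (Fin N₁ × Fin M) (Fin N₂ × Fin M) Φ₁ Φ₂)) =
      thetaDistLM F (Fin N₁ × Fin M)
          (adelicMpCont.omega F (Fin N₁ × Fin M)
            (T₁.map (algebraMap F (AdeleRing (𝓞 F) F)) ⊗ₖ TW.map (algebraMap F (AdeleRing (𝓞 F) F)))
            (adelicMpCont.twist F (Fin N₁ × Fin M)
              (T₁.map (algebraMap F (AdeleRing (𝓞 F) F)) ⊗ₖ TW.map (algebraMap F (AdeleRing (𝓞 F) F)))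
              (pairSmallLeft₁ F E c N₁ M e₁ J₁ JW s₁)
              (mpCharSmall₁ (seesawBigLeftSum F E c N₁ N₂ M eV J₁ J₂ JW s) (pairSmallLeft₁ F E c N₁ M e₁ J₁ JW s₁)
                (pairSmallLeft₂ F E c N₂ M e₂ J₂ JW s₂)
                (hs₃_seesawLeft F E c N₁ N₂ M eV e₁ e₂ J₁ J₂ JW hcδ hδ hd h₁ h₂ hW h₁d h₂d hWd hVd hJ₁ hJ₂ hJW hs hs₁ hs₂)
                (isUnit_kronecker_map F N₁ h₁d hWd) (isUnit_kronecker_map F N₂ h₂d hWd)) (u, g₁)) Φ₁) *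
        thetaDistLM F (Fin N₂ × Fin M)
          (adelicMpCont.omega F (Fin N₂ × Fin M)
            (T₂.map (algebraMap F (AdeleRing (𝓞 F) F)) ⊗ₖ TW.map (algebraMap F (AdeleRing (𝓞 F) F)))
            (adelicMpCont.twist F (Fin N₂ × Fin M)
              (T₂.map (algebraMap F (AdeleRing (𝓞 F) F)) ⊗ₖ TW.map (algebraMap F (AdeleRing (𝓞 F) F)))
              (pairSmallLeft₂ F E c N₂ M e₂ J₂ JW s₂)
              (mpCharSmall₂ (seesawBigLeftSum F E c N₁ N₂ M eV J₁ J₂ JW s) (pairSmallLeft₁ F E c N₁ M e₁ J₁ JW s₁)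
                (pairSmallLeft₂ F E c N₂ M e₂ J₂ JW s₂)
                (hs₃_seesawLeft F E c N₁ N₂ M eV e₁ e₂ J₁ J₂ JW hcδ hδ hd h₁ h₂ hW h₁d h₂d hWd hVd hJ₁ hJ₂ hJW hs hs₁ hs₂)
                (isUnit_kronecker_map F N₁ h₁d hWd) (isUnit_kronecker_map F N₂ h₂d hWd)) (u, g₂)) Φ₂) :=
  thetaDistLM_omega_tensorToSum_eq_mul_twistSmall _ _ _
    (hs₃_seesawLeft F E c N₁ N₂ M eV e₁ e₂ J₁ J₂ JW hcδ hδ hd h₁ h₂ hW h₁d h₂d hWd hVd hJ₁ hJ₂ hJW hs hs₁ hs₂) _ _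
    u g₁ g₂ Φ₁ Φ₂

omit [Algebra.IsQuadraticExtension F E] in
/-- **read-back of the block-sum theta functional to the big pair splitting of record**:
`Θ(ω(seesawBigLeftSum s (u,(g₁,g₂))) Ψ) = Θ(ω(s_pair(g₁ ⊕ᶠ g₂, u)) (R_{e_V} (R_{e_Σ}⁻¹ Ψ)))`.
[cite: Weil1964, Chap. III n° 41 Thm 6 p. 193] -/
theorem thetaDistLM_omega_seesawBigLeftSum (u : adelic F E c M JW) (g₁ : adelic F E c N₁ J₁) (g₂ : adelic F E c N₂ J₂)
    (Ψ : piSchwartzBruhat F ((Fin N₁ × Fin M) ⊕ (Fin N₂ × Fin M))) :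
    thetaDistLM F ((Fin N₁ × Fin M) ⊕ (Fin N₂ × Fin M))
        (adelicMpCont.omega F ((Fin N₁ × Fin M) ⊕ (Fin N₂ × Fin M))
          (Matrix.fromBlocks (T₁.map (algebraMap F (AdeleRing (𝓞 F) F)) ⊗ₖ TW.map (algebraMap F (AdeleRing (𝓞 F) F))) 0 0
            (T₂.map (algebraMap F (AdeleRing (𝓞 F) F)) ⊗ₖ TW.map (algebraMap F (AdeleRing (𝓞 F) F))))
          (seesawBigLeftSum F E c N₁ N₂ M eV J₁ J₂ JW s (u, (g₁, g₂))) Ψ) =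
      thetaDistLM F (Fin n)
        (adelicMpCont.omega F (Fin n) (adelicGram F eV (finSum N₁ N₂ T₁ T₂) TW)
          (pairSplitting F E c (N₁ + N₂) M eV (finSum N₁ N₂ J₁ J₂) JW s (adelicBlockDiag F E c N₁ N₂ J₁ J₂ (g₁, g₂), u))
          (piSBReindex F eV
            ((piSBReindex F ((finSumFinEquiv.prodCongr (Equiv.refl (Fin M))).symm.trans
              (Equiv.sumProdDistrib (Fin N₁) (Fin N₂) (Fin M)))).symm Ψ))) :=
  (congrArg (thetaDistLM F ((Fin N₁ × Fin M) ⊕ (Fin N₂ × Fin M)))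
      (omega_sumSeesawSplitting_apply ((finSumFinEquiv.prodCongr (Equiv.refl (Fin M))).symm.trans
          (Equiv.sumProdDistrib (Fin N₁) (Fin N₂) (Fin M))) (reindex_gram_finSum_left F N₁ N₂ M)
        (seesawBigLeft F E c N₁ N₂ M eV J₁ J₂ JW s) ((g₁, g₂), u) Ψ)).trans
    ((thetaDistLM_piSBReindex F ((finSumFinEquiv.prodCongr (Equiv.refl (Fin M))).symm.trans
        (Equiv.sumProdDistrib (Fin N₁) (Fin N₂) (Fin M))) _).trans
      ((congrArg (thetaDistLM F (Fin (N₁ + N₂) × Fin M))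
          (omega_seesawBigLeft_apply F E c N₁ N₂ M eV J₁ J₂ JW s ((g₁, g₂), u) _)).trans
        (thetaDistLM_piSBReindex F eV.symm _)))

/-- **[Liu2021]'s «theta functions restrict to theta functions» at the splitting of record, for ALL adelic arguments,
with the small splittings renormalised**: `Θ(ω(s_pair(g₁ ⊕ᶠ g₂, u)) (R_{e_V} R_{e_Σ}⁻¹ (Φ₁ ⊠ Φ₂))) =
Θ(ω(s₁′(u,g₁)) Φ₁) · Θ(ω(s₂′(u,g₂)) Φ₂)`. [cite: Liu2021, proof of Thm. 4.15 (FJcycle.tex l. 2204–2208)]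
[cite: Kudla1984, §1] -/
theorem thetaDistLM_pairSplitting_blockDiag_eq_mul_twist (u : adelic F E c M JW) (g₁ : adelic F E c N₁ J₁)
    (g₂ : adelic F E c N₂ J₂) (Φ₁ : piSchwartzBruhat F (Fin N₁ × Fin M)) (Φ₂ : piSchwartzBruhat F (Fin N₂ × Fin M)) :
    thetaDistLM F (Fin n)
        (adelicMpCont.omega F (Fin n) (adelicGram F eV (finSum N₁ N₂ T₁ T₂) TW)
          (pairSplitting F E c (N₁ + N₂) M eV (finSum N₁ N₂ J₁ J₂) JW s (adelicBlockDiag F E c N₁ N₂ J₁ J₂ (g₁, g₂), u))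
          (piSBReindex F eV
            ((piSBReindex F ((finSumFinEquiv.prodCongr (Equiv.refl (Fin M))).symm.trans
              (Equiv.sumProdDistrib (Fin N₁) (Fin N₂) (Fin M)))).symm
              (tensorToSum F (Fin N₁ × Fin M) (Fin N₂ × Fin M) Φ₁ Φ₂)))) =
      thetaDistLM F (Fin N₁ × Fin M)
          (adelicMpCont.omega F (Fin N₁ × Fin M)
            (T₁.map (algebraMap F (AdeleRing (𝓞 F) F)) ⊗ₖ TW.map (algebraMap F (AdeleRing (𝓞 F) F)))
            (adelicMpCont.twist F (Fin N₁ × Fin M)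
              (T₁.map (algebraMap F (AdeleRing (𝓞 F) F)) ⊗ₖ TW.map (algebraMap F (AdeleRing (𝓞 F) F)))
              (pairSmallLeft₁ F E c N₁ M e₁ J₁ JW s₁)
              (mpCharSmall₁ (seesawBigLeftSum F E c N₁ N₂ M eV J₁ J₂ JW s) (pairSmallLeft₁ F E c N₁ M e₁ J₁ JW s₁)
                (pairSmallLeft₂ F E c N₂ M e₂ J₂ JW s₂)
                (hs₃_seesawLeft F E c N₁ N₂ M eV e₁ e₂ J₁ J₂ JW hcδ hδ hd h₁ h₂ hW h₁d h₂d hWd hVd hJ₁ hJ₂ hJW hs hs₁ hs₂)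
                (isUnit_kronecker_map F N₁ h₁d hWd) (isUnit_kronecker_map F N₂ h₂d hWd)) (u, g₁)) Φ₁) *
        thetaDistLM F (Fin N₂ × Fin M)
          (adelicMpCont.omega F (Fin N₂ × Fin M)
            (T₂.map (algebraMap F (AdeleRing (𝓞 F) F)) ⊗ₖ TW.map (algebraMap F (AdeleRing (𝓞 F) F)))
            (adelicMpCont.twist F (Fin N₂ × Fin M)
              (T₂.map (algebraMap F (AdeleRing (𝓞 F) F)) ⊗ₖ TW.map (algebraMap F (AdeleRing (𝓞 F) F)))
              (pairSmallLeft₂ F E c N₂ M e₂ J₂ JW s₂)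
              (mpCharSmall₂ (seesawBigLeftSum F E c N₁ N₂ M eV J₁ J₂ JW s) (pairSmallLeft₁ F E c N₁ M e₁ J₁ JW s₁)
                (pairSmallLeft₂ F E c N₂ M e₂ J₂ JW s₂)
                (hs₃_seesawLeft F E c N₁ N₂ M eV e₁ e₂ J₁ J₂ JW hcδ hδ hd h₁ h₂ hW h₁d h₂d hWd hVd hJ₁ hJ₂ hJW hs hs₁ hs₂)
                (isUnit_kronecker_map F N₁ h₁d hWd) (isUnit_kronecker_map F N₂ h₂d hWd)) (u, g₂)) Φ₂) :=
  (thetaDistLM_omega_seesawBigLeftSum F E c N₁ N₂ M eV J₁ J₂ JW u g₁ g₂ _).symm.trans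
    (thetaDistLM_omega_seesawBigLeftSum_eq_mul_twist F E c N₁ N₂ M eV e₁ e₂ J₁ J₂ JW hcδ hδ hd h₁ h₂ hW h₁d h₂d hWd hVd
      hJ₁ hJ₂ hJW hs hs₁ hs₂ u g₁ g₂ Φ₁ Φ₂)

/-! ### §4 Rational points: the characters are automorphic; the renormalised small pair splittings are `Θ`-fixing -/

include hcδ hδ hd h₁ h₂ hW hWd hVd hJ₁ hJ₂ hJW hs in
/-- `Θ`-fixing at rational points of the big splitting in block-sum coordinates (range form).
[cite: Weil1964, Chap. III n° 41 Thm 6 p. 193] -/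
theorem coe_seesawBigLeftSum_mem_adelicMpTheta {u : adelic F E c M JW} (hu : u ∈ (toAdelic F E c M JW).range)
    {g₁ : adelic F E c N₁ J₁} (hg₁ : g₁ ∈ (toAdelic F E c N₁ J₁).range)
    {g₂ : adelic F E c N₂ J₂} (hg₂ : g₂ ∈ (toAdelic F E c N₂ J₂).range) :
    ((seesawBigLeftSum F E c N₁ N₂ M eV J₁ J₂ JW s (u, (g₁, g₂)) : adelicMpCont F _ _) : adelicMp F _ _) ∈
      adelicMpTheta F ((Fin N₁ × Fin M) ⊕ (Fin N₂ × Fin M))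
        (Matrix.fromBlocks (T₁.map (algebraMap F (AdeleRing (𝓞 F) F)) ⊗ₖ TW.map (algebraMap F (AdeleRing (𝓞 F) F))) 0 0
          (T₂.map (algebraMap F (AdeleRing (𝓞 F) F)) ⊗ₖ TW.map (algebraMap F (AdeleRing (𝓞 F) F)))) := by
  obtain ⟨γW, rfl⟩ := hu
  obtain ⟨γ₁, rfl⟩ := hg₁
  obtain ⟨γ₂, rfl⟩ := hg₂
  rw [seesawBigLeftSum_apply]
  exact (sumSeesawSplitting_mem_adelicMpTheta_iff ((finSumFinEquiv.prodCongr (Equiv.refl (Fin M))).symm.trans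
      (Equiv.sumProdDistrib (Fin N₁) (Fin N₂) (Fin M))) (reindex_gram_finSum_left F N₁ N₂ M)
      (seesawBigLeft F E c N₁ N₂ M eV J₁ J₂ JW s)
      ((toAdelic F E c N₁ J₁ γ₁, toAdelic F E c N₂ J₂ γ₂), toAdelic F E c M JW γW)).2
    (coe_seesawBigLeft_mem_adelicMpTheta F E c N₁ N₂ M eV J₁ J₂ JW hcδ hδ hd h₁ h₂ hW hWd hVd hJ₁ hJ₂ hJW hs γ₁ γ₂ γW)

include hcδ hδ hd h₁ hW h₁d hWd hJ₁ hJW hs₁ in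
/-- `Θ`-fixing at rational points of `pairSmallLeft₁ s₁` (range form). [cite: Weil1964, Chap. III n° 41 Thm 6 p. 193] -/
theorem coe_pairSmallLeft₁_mem_adelicMpTheta {u : adelic F E c M JW} (hu : u ∈ (toAdelic F E c M JW).range)
    {g₁ : adelic F E c N₁ J₁} (hg₁ : g₁ ∈ (toAdelic F E c N₁ J₁).range) :
    ((pairSmallLeft₁ F E c N₁ M e₁ J₁ JW s₁ (u, g₁) : adelicMpCont F _ _) : adelicMp F _ _) ∈
      adelicMpTheta F (Fin N₁ × Fin M)
        (T₁.map (algebraMap F (AdeleRing (𝓞 F) F)) ⊗ₖ TW.map (algebraMap F (AdeleRing (𝓞 F) F))) :=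
  coe_pairSmall₁_mem_adelicMpTheta F E c N₁ M e₁ J₁ JW hcδ hδ hd h₁ hW h₁d hWd hJ₁ hJW hs₁ hg₁ hu

include hcδ hδ hd h₂ hW h₂d hWd hJ₂ hJW hs₂ in
/-- `Θ`-fixing at rational points of `pairSmallLeft₂ s₂` (range form). [cite: Weil1964, Chap. III n° 41 Thm 6 p. 193] -/
theorem coe_pairSmallLeft₂_mem_adelicMpTheta {u : adelic F E c M JW} (hu : u ∈ (toAdelic F E c M JW).range)
    {g₂ : adelic F E c N₂ J₂} (hg₂ : g₂ ∈ (toAdelic F E c N₂ J₂).range) :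
    ((pairSmallLeft₂ F E c N₂ M e₂ J₂ JW s₂ (u, g₂) : adelicMpCont F _ _) : adelicMp F _ _) ∈
      adelicMpTheta F (Fin N₂ × Fin M)
        (T₂.map (algebraMap F (AdeleRing (𝓞 F) F)) ⊗ₖ TW.map (algebraMap F (AdeleRing (𝓞 F) F))) :=
  coe_pairSmall₂_mem_adelicMpTheta F E c N₂ M e₂ J₂ JW hcδ hδ hd h₂ hW h₂d hWd hJ₂ hJW hs₂ hg₂ hu

/-- **`λ_W = 1` on `U(J_W)(F)`** — the `U(W)`-factor of the V-side see-saw character is AUTOMORPHIC.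
[cite: Weil1964, Chap. III n° 41 Thm 6 p. 193] -/
theorem charW_eq_one_of_rational {u : adelic F E c M JW} (hu : u ∈ (toAdelic F E c M JW).range) :
    charW F E c N₁ N₂ M eV e₁ e₂ J₁ J₂ JW hcδ hδ hd h₁ h₂ hW h₁d h₂d hWd hVd hJ₁ hJ₂ hJW hs hs₁ hs₂ u = 1 :=
  mpCharV_eq_one_of_mem_adelicMpTheta _ _ _
    (hs₃_seesawLeft F E c N₁ N₂ M eV e₁ e₂ J₁ J₂ JW hcδ hδ hd h₁ h₂ hW h₁d h₂d hWd hVd hJ₁ hJ₂ hJW hs hs₁ hs₂) _ _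
    (coe_seesawBigLeftSum_mem_adelicMpTheta F E c N₁ N₂ M eV J₁ J₂ JW hcδ hδ hd h₁ h₂ hW hWd hVd hJ₁ hJ₂ hJW hs hu
      (one_mem _) (one_mem _))
    (coe_pairSmallLeft₁_mem_adelicMpTheta F E c N₁ M e₁ J₁ JW hcδ hδ hd h₁ hW h₁d hWd hJ₁ hJW hs₁ hu (one_mem _))
    (coe_pairSmallLeft₂_mem_adelicMpTheta F E c N₂ M e₂ J₂ JW hcδ hδ hd h₂ hW h₂d hWd hJ₂ hJW hs₂ hu (one_mem _))

/-- **`λ₁ = 1` on `U(J₁)(F)`** — the `U(V⋆)`-factor is AUTOMORPHIC. [cite: Weil1964, Chap. III n° 41 Thm 6 p. 193] -/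
theorem charLeft₁_eq_one_of_rational {g₁ : adelic F E c N₁ J₁} (hg₁ : g₁ ∈ (toAdelic F E c N₁ J₁).range) :
    charLeft₁ F E c N₁ N₂ M eV e₁ e₂ J₁ J₂ JW hcδ hδ hd h₁ h₂ hW h₁d h₂d hWd hVd hJ₁ hJ₂ hJW hs hs₁ hs₂ g₁ = 1 :=
  mpChar₁_eq_one_of_mem_adelicMpTheta _ _ _
    (hs₃_seesawLeft F E c N₁ N₂ M eV e₁ e₂ J₁ J₂ JW hcδ hδ hd h₁ h₂ hW h₁d h₂d hWd hVd hJ₁ hJ₂ hJW hs hs₁ hs₂) _ _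
    (coe_seesawBigLeftSum_mem_adelicMpTheta F E c N₁ N₂ M eV J₁ J₂ JW hcδ hδ hd h₁ h₂ hW hWd hVd hJ₁ hJ₂ hJW hs
      (one_mem _) hg₁ (one_mem _))
    (coe_pairSmallLeft₁_mem_adelicMpTheta F E c N₁ M e₁ J₁ JW hcδ hδ hd h₁ hW h₁d hWd hJ₁ hJW hs₁ (one_mem _) hg₁)

/-- **`λ₂ = 1` on `U(J₂)(F)`** — the `U(V⋆^⊥)`-factor is AUTOMORPHIC. [cite: Weil1964, Chap. III n° 41 Thm 6 p. 193] -/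
theorem charLeft₂_eq_one_of_rational {g₂ : adelic F E c N₂ J₂} (hg₂ : g₂ ∈ (toAdelic F E c N₂ J₂).range) :
    charLeft₂ F E c N₁ N₂ M eV e₁ e₂ J₁ J₂ JW hcδ hδ hd h₁ h₂ hW h₁d h₂d hWd hVd hJ₁ hJ₂ hJW hs hs₁ hs₂ g₂ = 1 :=
  mpChar₂_eq_one_of_mem_adelicMpTheta _ _ _
    (hs₃_seesawLeft F E c N₁ N₂ M eV e₁ e₂ J₁ J₂ JW hcδ hδ hd h₁ h₂ hW h₁d h₂d hWd hVd hJ₁ hJ₂ hJW hs hs₁ hs₂) _ _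
    (coe_seesawBigLeftSum_mem_adelicMpTheta F E c N₁ N₂ M eV J₁ J₂ JW hcδ hδ hd h₁ h₂ hW hWd hVd hJ₁ hJ₂ hJW hs
      (one_mem _) (one_mem _) hg₂)
    (coe_pairSmallLeft₂_mem_adelicMpTheta F E c N₂ M e₂ J₂ JW hcδ hδ hd h₂ hW h₂d hWd hJ₂ hJW hs₂ (one_mem _) hg₂)

/-- **At rational points the renormalised first small pair splitting AGREES with `pairSmallLeft₁ s₁`**: for
`u ∈ U(J_W)(F)`, `g₁ ∈ U(J₁)(F)`, `(pairSmallLeft₁ s₁ ⊗ c₁)(u,g₁) = pairSmallLeft₁ s₁ (u,g₁)` — the renormalisation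
is invisible on rational points. [cite: Weil1964, Chap. III n° 41 Thm 6 p. 193] -/
theorem twist_pairSmallLeft₁_apply_of_rational {u : adelic F E c M JW} (hu : u ∈ (toAdelic F E c M JW).range)
    {g₁ : adelic F E c N₁ J₁} (hg₁ : g₁ ∈ (toAdelic F E c N₁ J₁).range) :
    adelicMpCont.twist F (Fin N₁ × Fin M)
        (T₁.map (algebraMap F (AdeleRing (𝓞 F) F)) ⊗ₖ TW.map (algebraMap F (AdeleRing (𝓞 F) F)))
        (pairSmallLeft₁ F E c N₁ M e₁ J₁ JW s₁)
        (mpCharSmall₁ (seesawBigLeftSum F E c N₁ N₂ M eV J₁ J₂ JW s) (pairSmallLeft₁ F E c N₁ M e₁ J₁ JW s₁)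
          (pairSmallLeft₂ F E c N₂ M e₂ J₂ JW s₂)
          (hs₃_seesawLeft F E c N₁ N₂ M eV e₁ e₂ J₁ J₂ JW hcδ hδ hd h₁ h₂ hW h₁d h₂d hWd hVd hJ₁ hJ₂ hJW hs hs₁ hs₂)
          (isUnit_kronecker_map F N₁ h₁d hWd) (isUnit_kronecker_map F N₂ h₂d hWd)) (u, g₁) =
      pairSmallLeft₁ F E c N₁ M e₁ J₁ JW s₁ (u, g₁) :=
  twistSmall₁_apply_eq_of_mem_adelicMpTheta _ _ _
    (hs₃_seesawLeft F E c N₁ N₂ M eV e₁ e₂ J₁ J₂ JW hcδ hδ hd h₁ h₂ hW h₁d h₂d hWd hVd hJ₁ hJ₂ hJW hs hs₁ hs₂) _ _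
    (coe_seesawBigLeftSum_mem_adelicMpTheta F E c N₁ N₂ M eV J₁ J₂ JW hcδ hδ hd h₁ h₂ hW hWd hVd hJ₁ hJ₂ hJW hs hu
      (one_mem _) (one_mem _))
    (coe_pairSmallLeft₁_mem_adelicMpTheta F E c N₁ M e₁ J₁ JW hcδ hδ hd h₁ hW h₁d hWd hJ₁ hJW hs₁ hu (one_mem _))
    (coe_pairSmallLeft₂_mem_adelicMpTheta F E c N₂ M e₂ J₂ JW hcδ hδ hd h₂ hW h₂d hWd hJ₂ hJW hs₂ hu (one_mem _))
    (coe_seesawBigLeftSum_mem_adelicMpTheta F E c N₁ N₂ M eV J₁ J₂ JW hcδ hδ hd h₁ h₂ hW hWd hVd hJ₁ hJ₂ hJW hs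
      (one_mem _) hg₁ (one_mem _))
    (coe_pairSmallLeft₁_mem_adelicMpTheta F E c N₁ M e₁ J₁ JW hcδ hδ hd h₁ hW h₁d hWd hJ₁ hJW hs₁ (one_mem _) hg₁)

/-- **At rational points the renormalised second small pair splitting AGREES with `pairSmallLeft₂ s₂`**.
[cite: Weil1964, Chap. III n° 41 Thm 6 p. 193] -/
theorem twist_pairSmallLeft₂_apply_of_rational (u : adelic F E c M JW)
    {g₂ : adelic F E c N₂ J₂} (hg₂ : g₂ ∈ (toAdelic F E c N₂ J₂).range) :
    adelicMpCont.twist F (Fin N₂ × Fin M)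
        (T₂.map (algebraMap F (AdeleRing (𝓞 F) F)) ⊗ₖ TW.map (algebraMap F (AdeleRing (𝓞 F) F)))
        (pairSmallLeft₂ F E c N₂ M e₂ J₂ JW s₂)
        (mpCharSmall₂ (seesawBigLeftSum F E c N₁ N₂ M eV J₁ J₂ JW s) (pairSmallLeft₁ F E c N₁ M e₁ J₁ JW s₁)
          (pairSmallLeft₂ F E c N₂ M e₂ J₂ JW s₂)
          (hs₃_seesawLeft F E c N₁ N₂ M eV e₁ e₂ J₁ J₂ JW hcδ hδ hd h₁ h₂ hW h₁d h₂d hWd hVd hJ₁ hJ₂ hJW hs hs₁ hs₂)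
          (isUnit_kronecker_map F N₁ h₁d hWd) (isUnit_kronecker_map F N₂ h₂d hWd)) (u, g₂) =
      pairSmallLeft₂ F E c N₂ M e₂ J₂ JW s₂ (u, g₂) :=
  twistSmall₂_apply_eq_of_mem_adelicMpTheta _ _ _
    (hs₃_seesawLeft F E c N₁ N₂ M eV e₁ e₂ J₁ J₂ JW hcδ hδ hd h₁ h₂ hW h₁d h₂d hWd hVd hJ₁ hJ₂ hJW hs hs₁ hs₂) _ _ u
    (coe_seesawBigLeftSum_mem_adelicMpTheta F E c N₁ N₂ M eV J₁ J₂ JW hcδ hδ hd h₁ h₂ hW hWd hVd hJ₁ hJ₂ hJW hs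
      (one_mem _) (one_mem _) hg₂)
    (coe_pairSmallLeft₂_mem_adelicMpTheta F E c N₂ M e₂ J₂ JW hcδ hδ hd h₂ hW h₂d hWd hJ₂ hJW hs₂ (one_mem _) hg₂)

/-- **The renormalised first small pair splitting is `Θ`-fixing at rational points** (the input `hrat` of
`Weil1964.ThetaKernelDatum.adelicOfDualPair` for the theta kernel of `(U(J₁), U(J_W))` built from `s₁′`): for
`u ∈ U(J_W)(F)`, `g₁ ∈ U(J₁)(F)`, `(pairSmallLeft₁ s₁ ⊗ c₁)(u,g₁) ∈ Mp^Θ`. [cite: Weil1964, Chap. III n° 41 Thm 6 p. 193] -/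
theorem coe_twist_pairSmallLeft₁_mem_adelicMpTheta {u : adelic F E c M JW} (hu : u ∈ (toAdelic F E c M JW).range)
    {g₁ : adelic F E c N₁ J₁} (hg₁ : g₁ ∈ (toAdelic F E c N₁ J₁).range) :
    ((adelicMpCont.twist F (Fin N₁ × Fin M)
        (T₁.map (algebraMap F (AdeleRing (𝓞 F) F)) ⊗ₖ TW.map (algebraMap F (AdeleRing (𝓞 F) F)))
        (pairSmallLeft₁ F E c N₁ M e₁ J₁ JW s₁)
        (mpCharSmall₁ (seesawBigLeftSum F E c N₁ N₂ M eV J₁ J₂ JW s) (pairSmallLeft₁ F E c N₁ M e₁ J₁ JW s₁)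
          (pairSmallLeft₂ F E c N₂ M e₂ J₂ JW s₂)
          (hs₃_seesawLeft F E c N₁ N₂ M eV e₁ e₂ J₁ J₂ JW hcδ hδ hd h₁ h₂ hW h₁d h₂d hWd hVd hJ₁ hJ₂ hJW hs hs₁ hs₂)
          (isUnit_kronecker_map F N₁ h₁d hWd) (isUnit_kronecker_map F N₂ h₂d hWd)) (u, g₁) :
        adelicMpCont F _ _) : adelicMp F _ _) ∈
      adelicMpTheta F (Fin N₁ × Fin M)
        (T₁.map (algebraMap F (AdeleRing (𝓞 F) F)) ⊗ₖ TW.map (algebraMap F (AdeleRing (𝓞 F) F))) :=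
  twistSmall₁_mem_adelicMpTheta _ _ _
    (hs₃_seesawLeft F E c N₁ N₂ M eV e₁ e₂ J₁ J₂ JW hcδ hδ hd h₁ h₂ hW h₁d h₂d hWd hVd hJ₁ hJ₂ hJW hs hs₁ hs₂) _ _
    (coe_seesawBigLeftSum_mem_adelicMpTheta F E c N₁ N₂ M eV J₁ J₂ JW hcδ hδ hd h₁ h₂ hW hWd hVd hJ₁ hJ₂ hJW hs hu
      (one_mem _) (one_mem _))
    (coe_pairSmallLeft₁_mem_adelicMpTheta F E c N₁ M e₁ J₁ JW hcδ hδ hd h₁ hW h₁d hWd hJ₁ hJW hs₁ hu (one_mem _))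
    (coe_pairSmallLeft₂_mem_adelicMpTheta F E c N₂ M e₂ J₂ JW hcδ hδ hd h₂ hW h₂d hWd hJ₂ hJW hs₂ hu (one_mem _))
    (coe_seesawBigLeftSum_mem_adelicMpTheta F E c N₁ N₂ M eV J₁ J₂ JW hcδ hδ hd h₁ h₂ hW hWd hVd hJ₁ hJ₂ hJW hs
      (one_mem _) hg₁ (one_mem _))
    (coe_pairSmallLeft₁_mem_adelicMpTheta F E c N₁ M e₁ J₁ JW hcδ hδ hd h₁ hW h₁d hWd hJ₁ hJW hs₁ (one_mem _) hg₁)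
    (coe_pairSmallLeft₁_mem_adelicMpTheta F E c N₁ M e₁ J₁ JW hcδ hδ hd h₁ hW h₁d hWd hJ₁ hJW hs₁ hu hg₁)

/-- **The renormalised second small pair splitting is `Θ`-fixing at rational points.**
[cite: Weil1964, Chap. III n° 41 Thm 6 p. 193] -/
theorem coe_twist_pairSmallLeft₂_mem_adelicMpTheta {u : adelic F E c M JW} (hu : u ∈ (toAdelic F E c M JW).range)
    {g₂ : adelic F E c N₂ J₂} (hg₂ : g₂ ∈ (toAdelic F E c N₂ J₂).range) :
    ((adelicMpCont.twist F (Fin N₂ × Fin M)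
        (T₂.map (algebraMap F (AdeleRing (𝓞 F) F)) ⊗ₖ TW.map (algebraMap F (AdeleRing (𝓞 F) F)))
        (pairSmallLeft₂ F E c N₂ M e₂ J₂ JW s₂)
        (mpCharSmall₂ (seesawBigLeftSum F E c N₁ N₂ M eV J₁ J₂ JW s) (pairSmallLeft₁ F E c N₁ M e₁ J₁ JW s₁)
          (pairSmallLeft₂ F E c N₂ M e₂ J₂ JW s₂)
          (hs₃_seesawLeft F E c N₁ N₂ M eV e₁ e₂ J₁ J₂ JW hcδ hδ hd h₁ h₂ hW h₁d h₂d hWd hVd hJ₁ hJ₂ hJW hs hs₁ hs₂)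
          (isUnit_kronecker_map F N₁ h₁d hWd) (isUnit_kronecker_map F N₂ h₂d hWd)) (u, g₂) :
        adelicMpCont F _ _) : adelicMp F _ _) ∈
      adelicMpTheta F (Fin N₂ × Fin M)
        (T₂.map (algebraMap F (AdeleRing (𝓞 F) F)) ⊗ₖ TW.map (algebraMap F (AdeleRing (𝓞 F) F))) :=
  twistSmall₂_mem_adelicMpTheta _ _ _
    (hs₃_seesawLeft F E c N₁ N₂ M eV e₁ e₂ J₁ J₂ JW hcδ hδ hd h₁ h₂ hW h₁d h₂d hWd hVd hJ₁ hJ₂ hJW hs hs₁ hs₂) _ _ u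
    (coe_seesawBigLeftSum_mem_adelicMpTheta F E c N₁ N₂ M eV J₁ J₂ JW hcδ hδ hd h₁ h₂ hW hWd hVd hJ₁ hJ₂ hJW hs
      (one_mem _) (one_mem _) hg₂)
    (coe_pairSmallLeft₂_mem_adelicMpTheta F E c N₂ M e₂ J₂ JW hcδ hδ hd h₂ hW h₂d hWd hJ₂ hJW hs₂ (one_mem _) hg₂)
    (coe_pairSmallLeft₂_mem_adelicMpTheta F E c N₂ M e₂ J₂ JW hcδ hδ hd h₂ hW h₂d hWd hJ₂ hJW hs₂ hu hg₂)

/-- the renormalised small pair splittings lie over the same symplectic maps as the original ones (first pair).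
[cite: MoeglinVignerasWaldspurger1987, Chap. 2 II.1 (B)] -/
theorem proj_twist_pairSmallLeft₁ (p : adelic F E c M JW × adelic F E c N₁ J₁) :
    adelicMpCont.proj F (Fin N₁ × Fin M)
        (T₁.map (algebraMap F (AdeleRing (𝓞 F) F)) ⊗ₖ TW.map (algebraMap F (AdeleRing (𝓞 F) F)))
        (adelicMpCont.twist F (Fin N₁ × Fin M)
          (T₁.map (algebraMap F (AdeleRing (𝓞 F) F)) ⊗ₖ TW.map (algebraMap F (AdeleRing (𝓞 F) F)))
          (pairSmallLeft₁ F E c N₁ M e₁ J₁ JW s₁)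
          (mpCharSmall₁ (seesawBigLeftSum F E c N₁ N₂ M eV J₁ J₂ JW s) (pairSmallLeft₁ F E c N₁ M e₁ J₁ JW s₁)
            (pairSmallLeft₂ F E c N₂ M e₂ J₂ JW s₂)
            (hs₃_seesawLeft F E c N₁ N₂ M eV e₁ e₂ J₁ J₂ JW hcδ hδ hd h₁ h₂ hW h₁d h₂d hWd hVd hJ₁ hJ₂ hJW hs hs₁ hs₂)
            (isUnit_kronecker_map F N₁ h₁d hWd) (isUnit_kronecker_map F N₂ h₂d hWd)) p) =
      adelicMpCont.proj F (Fin N₁ × Fin M)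
        (T₁.map (algebraMap F (AdeleRing (𝓞 F) F)) ⊗ₖ TW.map (algebraMap F (AdeleRing (𝓞 F) F)))
        (pairSmallLeft₁ F E c N₁ M e₁ J₁ JW s₁ p) :=
  adelicMpCont.proj_twist _ _ p

/-- … (second pair). [cite: MoeglinVignerasWaldspurger1987, Chap. 2 II.1 (B)] -/
theorem proj_twist_pairSmallLeft₂ (p : adelic F E c M JW × adelic F E c N₂ J₂) :
    adelicMpCont.proj F (Fin N₂ × Fin M)
        (T₂.map (algebraMap F (AdeleRing (𝓞 F) F)) ⊗ₖ TW.map (algebraMap F (AdeleRing (𝓞 F) F)))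
        (adelicMpCont.twist F (Fin N₂ × Fin M)
          (T₂.map (algebraMap F (AdeleRing (𝓞 F) F)) ⊗ₖ TW.map (algebraMap F (AdeleRing (𝓞 F) F)))
          (pairSmallLeft₂ F E c N₂ M e₂ J₂ JW s₂)
          (mpCharSmall₂ (seesawBigLeftSum F E c N₁ N₂ M eV J₁ J₂ JW s) (pairSmallLeft₁ F E c N₁ M e₁ J₁ JW s₁)
            (pairSmallLeft₂ F E c N₂ M e₂ J₂ JW s₂)
            (hs₃_seesawLeft F E c N₁ N₂ M eV e₁ e₂ J₁ J₂ JW hcδ hδ hd h₁ h₂ hW h₁d h₂d hWd hVd hJ₁ hJ₂ hJW hs hs₁ hs₂)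
            (isUnit_kronecker_map F N₁ h₁d hWd) (isUnit_kronecker_map F N₂ h₂d hWd)) p) =
      adelicMpCont.proj F (Fin N₂ × Fin M)
        (T₂.map (algebraMap F (AdeleRing (𝓞 F) F)) ⊗ₖ TW.map (algebraMap F (AdeleRing (𝓞 F) F)))
        (pairSmallLeft₂ F E c N₂ M e₂ J₂ JW s₂ p) :=
  adelicMpCont.proj_twist _ _ p

/-! ### Continuity of the characters and of the renormalised small pair splittings -/

/-- **`λ_W` is continuous** along continuous pair splittings. [cite: Weil1964, Chap. III n° 39 p. 189] -/
theorem continuous_charW (hc : Continuous (pairSplitting F E c (N₁ + N₂) M eV (finSum N₁ N₂ J₁ J₂) JW s))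
    (hc₁ : Continuous (pairSplitting F E c N₁ M e₁ J₁ JW s₁)) (hc₂ : Continuous (pairSplitting F E c N₂ M e₂ J₂ JW s₂)) :
    Continuous fun u : adelic F E c M JW =>
      (charW F E c N₁ N₂ M eV e₁ e₂ J₁ J₂ JW hcδ hδ hd h₁ h₂ hW h₁d h₂d hWd hVd hJ₁ hJ₂ hJW hs hs₁ hs₂ u : ℂ) :=
  continuous_mpCharV _ _ _
    (hs₃_seesawLeft F E c N₁ N₂ M eV e₁ e₂ J₁ J₂ JW hcδ hδ hd h₁ h₂ hW h₁d h₂d hWd hVd hJ₁ hJ₂ hJW hs hs₁ hs₂) _ _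
    (continuous_seesawBigLeftSum F E c N₁ N₂ M eV J₁ J₂ JW hc) (continuous_pairSmallLeft₁ F E c N₁ M e₁ J₁ JW hc₁)
    (continuous_pairSmallLeft₂ F E c N₂ M e₂ J₂ JW hc₂)

/-- **`λ₁` is continuous.** [cite: Weil1964, Chap. III n° 39 p. 189] -/
theorem continuous_charLeft₁ (hc : Continuous (pairSplitting F E c (N₁ + N₂) M eV (finSum N₁ N₂ J₁ J₂) JW s))
    (hc₁ : Continuous (pairSplitting F E c N₁ M e₁ J₁ JW s₁)) (hc₂ : Continuous (pairSplitting F E c N₂ M e₂ J₂ JW s₂)) :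
    Continuous fun g₁ : adelic F E c N₁ J₁ =>
      (charLeft₁ F E c N₁ N₂ M eV e₁ e₂ J₁ J₂ JW hcδ hδ hd h₁ h₂ hW h₁d h₂d hWd hVd hJ₁ hJ₂ hJW hs hs₁ hs₂ g₁ : ℂ) :=
  continuous_mpChar₁ _ _ _
    (hs₃_seesawLeft F E c N₁ N₂ M eV e₁ e₂ J₁ J₂ JW hcδ hδ hd h₁ h₂ hW h₁d h₂d hWd hVd hJ₁ hJ₂ hJW hs hs₁ hs₂) _ _
    (continuous_seesawBigLeftSum F E c N₁ N₂ M eV J₁ J₂ JW hc) (continuous_pairSmallLeft₁ F E c N₁ M e₁ J₁ JW hc₁)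
    (continuous_pairSmallLeft₂ F E c N₂ M e₂ J₂ JW hc₂)

/-- **`λ₂` is continuous.** [cite: Weil1964, Chap. III n° 39 p. 189] -/
theorem continuous_charLeft₂ (hc : Continuous (pairSplitting F E c (N₁ + N₂) M eV (finSum N₁ N₂ J₁ J₂) JW s))
    (hc₁ : Continuous (pairSplitting F E c N₁ M e₁ J₁ JW s₁)) (hc₂ : Continuous (pairSplitting F E c N₂ M e₂ J₂ JW s₂)) :
    Continuous fun g₂ : adelic F E c N₂ J₂ =>
      (charLeft₂ F E c N₁ N₂ M eV e₁ e₂ J₁ J₂ JW hcδ hδ hd h₁ h₂ hW h₁d h₂d hWd hVd hJ₁ hJ₂ hJW hs hs₁ hs₂ g₂ : ℂ) :=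
  continuous_mpChar₂ _ _ _
    (hs₃_seesawLeft F E c N₁ N₂ M eV e₁ e₂ J₁ J₂ JW hcδ hδ hd h₁ h₂ hW h₁d h₂d hWd hVd hJ₁ hJ₂ hJW hs hs₁ hs₂) _ _
    (continuous_seesawBigLeftSum F E c N₁ N₂ M eV J₁ J₂ JW hc) (continuous_pairSmallLeft₁ F E c N₁ M e₁ J₁ JW hc₁)
    (continuous_pairSmallLeft₂ F E c N₂ M e₂ J₂ JW hc₂)

end Compatible

/-! ## §5 (append) Continuity of the scheme-(small) characters and of the renormalised small pair splittings -/

section ContinuityTwist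

variable (F E : Type) [Field F] [NumberField F] [Field E] [NumberField E] [Algebra F E]
variable (c : E ≃ₐ[F] E) (N₁ N₂ M : ℕ) {n n₁ n₂ : ℕ}
  (eV : Fin (N₁ + N₂) × Fin M ≃ Fin n) (e₁ : Fin N₁ × Fin M ≃ Fin n₁) (e₂ : Fin N₂ × Fin M ≃ Fin n₂)
variable (J₁ : Matrix (Fin N₁) (Fin N₁) E) (J₂ : Matrix (Fin N₂) (Fin N₂) E) (JW : Matrix (Fin M) (Fin M) E)
variable {T₁ : Matrix (Fin N₁) (Fin N₁) F} {T₂ : Matrix (Fin N₂) (Fin N₂) F} {TW : Matrix (Fin M) (Fin M) F}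
variable [Algebra.IsQuadraticExtension F E] {δ : E} (hcδ : c δ = -δ) (hδ : δ ≠ 0) {d : F}
  (hd : δ * δ = algebraMap F E d) (h₁ : T₁.IsSymm) (h₂ : T₂.IsSymm) (hW : TW.IsSymm) (h₁d : IsUnit T₁.det)
  (h₂d : IsUnit T₂.det) (hWd : IsUnit TW.det) (hVd : IsUnit (finSum N₁ N₂ T₁ T₂).det)
  (hJ₁ : J₁ = T₁.map (algebraMap F E)) (hJ₂ : J₂ = T₂.map (algebraMap F E)) (hJW : JW = TW.map (algebraMap F E))
  {s : adelicPair F E c (N₁ + N₂) M (finSum N₁ N₂ J₁ J₂) JW →*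
    adelicMpCont F (Fin n) (adelicGram F eV (finSum N₁ N₂ T₁ T₂) TW)}
  {s₁ : adelicPair F E c N₁ M J₁ JW →* adelicMpCont F (Fin n₁) (adelicGram F e₁ T₁ TW)}
  {s₂ : adelicPair F E c N₂ M J₂ JW →* adelicMpCont F (Fin n₂) (adelicGram F e₂ T₂ TW)}
  (hs : (splittingDatum F E c (N₁ + N₂) M eV (finSum N₁ N₂ J₁ J₂) JW hcδ hδ hd (isSymm_finSum h₁ h₂) hW hVd hWd
    (finSum_eq_map_finSum F E N₁ N₂ J₁ J₂ hJ₁ hJ₂) hJW).IsCompatible s)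
  (hs₁ : (splittingDatum F E c N₁ M e₁ J₁ JW hcδ hδ hd h₁ hW h₁d hWd hJ₁ hJW).IsCompatible s₁)
  (hs₂ : (splittingDatum F E c N₂ M e₂ J₂ JW hcδ hδ hd h₂ hW h₂d hWd hJ₂ hJW).IsCompatible s₂)

/-- **the first scheme-(small) character `c₁(u,g₁) = λ_W u · λ₁ g₁` is continuous** along continuous pair splittings.
[cite: Weil1964, Chap. III n° 39 p. 189] -/
theorem continuous_mpCharSmall₁_seesawLeft
    (hc : Continuous (pairSplitting F E c (N₁ + N₂) M eV (finSum N₁ N₂ J₁ J₂) JW s))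
    (hc₁ : Continuous (pairSplitting F E c N₁ M e₁ J₁ JW s₁)) (hc₂ : Continuous (pairSplitting F E c N₂ M e₂ J₂ JW s₂)) :
    Continuous fun p : adelic F E c M JW × adelic F E c N₁ J₁ =>
      ((mpCharSmall₁ (seesawBigLeftSum F E c N₁ N₂ M eV J₁ J₂ JW s) (pairSmallLeft₁ F E c N₁ M e₁ J₁ JW s₁)
          (pairSmallLeft₂ F E c N₂ M e₂ J₂ JW s₂)
          (hs₃_seesawLeft F E c N₁ N₂ M eV e₁ e₂ J₁ J₂ JW hcδ hδ hd h₁ h₂ hW h₁d h₂d hWd hVd hJ₁ hJ₂ hJW hs hs₁ hs₂)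
          (isUnit_kronecker_map F N₁ h₁d hWd) (isUnit_kronecker_map F N₂ h₂d hWd) p : ℂˣ) : ℂ) :=
  (((continuous_charW F E c N₁ N₂ M eV e₁ e₂ J₁ J₂ JW hcδ hδ hd h₁ h₂ hW h₁d h₂d hWd hVd hJ₁ hJ₂ hJW hs hs₁ hs₂ hc hc₁
        hc₂).comp continuous_fst).mul
      ((continuous_charLeft₁ F E c N₁ N₂ M eV e₁ e₂ J₁ J₂ JW hcδ hδ hd h₁ h₂ hW h₁d h₂d hWd hVd hJ₁ hJ₂ hJW hs hs₁ hs₂ hc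
        hc₁ hc₂).comp continuous_snd)).congr
    fun p => by
      obtain ⟨u, g₁⟩ := p
      exact ((congrArg Units.val (mpCharSmall₁_seesawLeft_apply F E c N₁ N₂ M eV e₁ e₂ J₁ J₂ JW hcδ hδ hd h₁ h₂ hW h₁d
        h₂d hWd hVd hJ₁ hJ₂ hJW hs hs₁ hs₂ u g₁)).trans (Units.val_mul _ _)).symm

/-- **the second scheme-(small) character `c₂(u,g₂) = λ₂ g₂` is continuous.** [cite: Weil1964, Chap. III n° 39 p. 189] -/
theorem continuous_mpCharSmall₂_seesawLeft
    (hc : Continuous (pairSplitting F E c (N₁ + N₂) M eV (finSum N₁ N₂ J₁ J₂) JW s))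
    (hc₁ : Continuous (pairSplitting F E c N₁ M e₁ J₁ JW s₁)) (hc₂ : Continuous (pairSplitting F E c N₂ M e₂ J₂ JW s₂)) :
    Continuous fun p : adelic F E c M JW × adelic F E c N₂ J₂ =>
      ((mpCharSmall₂ (seesawBigLeftSum F E c N₁ N₂ M eV J₁ J₂ JW s) (pairSmallLeft₁ F E c N₁ M e₁ J₁ JW s₁)
          (pairSmallLeft₂ F E c N₂ M e₂ J₂ JW s₂)
          (hs₃_seesawLeft F E c N₁ N₂ M eV e₁ e₂ J₁ J₂ JW hcδ hδ hd h₁ h₂ hW h₁d h₂d hWd hVd hJ₁ hJ₂ hJW hs hs₁ hs₂)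
          (isUnit_kronecker_map F N₁ h₁d hWd) (isUnit_kronecker_map F N₂ h₂d hWd) p : ℂˣ) : ℂ) :=
  (continuous_charLeft₂ F E c N₁ N₂ M eV e₁ e₂ J₁ J₂ JW hcδ hδ hd h₁ h₂ hW h₁d h₂d hWd hVd hJ₁ hJ₂ hJW hs hs₁ hs₂ hc hc₁
      hc₂).comp continuous_snd

/-- **the renormalised first small pair splitting `pairSmallLeft₁ s₁ ⊗ c₁` is continuous** along continuous pair splittings
(with `proj_twist_pairSmallLeft₁` and `coe_twist_pairSmallLeft₁_mem_adelicMpTheta`: all three inputs `ρ`, `hrat`, continuity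
of `Weil1964.ThetaKernelDatum.adelicOfDualPair` for the theta kernel of `(U(J₁), U(J_W))` built from the renormalised
splitting). [cite: Weil1964, Chap. III n° 39 p. 189] -/
theorem continuous_twist_pairSmallLeft₁
    (hc : Continuous (pairSplitting F E c (N₁ + N₂) M eV (finSum N₁ N₂ J₁ J₂) JW s))
    (hc₁ : Continuous (pairSplitting F E c N₁ M e₁ J₁ JW s₁)) (hc₂ : Continuous (pairSplitting F E c N₂ M e₂ J₂ JW s₂)) :
    Continuous (adelicMpCont.twist F (Fin N₁ × Fin M)
      (T₁.map (algebraMap F (AdeleRing (𝓞 F) F)) ⊗ₖ TW.map (algebraMap F (AdeleRing (𝓞 F) F)))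
      (pairSmallLeft₁ F E c N₁ M e₁ J₁ JW s₁)
      (mpCharSmall₁ (seesawBigLeftSum F E c N₁ N₂ M eV J₁ J₂ JW s) (pairSmallLeft₁ F E c N₁ M e₁ J₁ JW s₁)
        (pairSmallLeft₂ F E c N₂ M e₂ J₂ JW s₂)
        (hs₃_seesawLeft F E c N₁ N₂ M eV e₁ e₂ J₁ J₂ JW hcδ hδ hd h₁ h₂ hW h₁d h₂d hWd hVd hJ₁ hJ₂ hJW hs hs₁ hs₂)
        (isUnit_kronecker_map F N₁ h₁d hWd) (isUnit_kronecker_map F N₂ h₂d hWd))) :=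
  adelicMpCont.continuous_twist _ _ (continuous_pairSmallLeft₁ F E c N₁ M e₁ J₁ JW hc₁)
    (continuous_mpCharSmall₁_seesawLeft F E c N₁ N₂ M eV e₁ e₂ J₁ J₂ JW hcδ hδ hd h₁ h₂ hW h₁d h₂d hWd hVd hJ₁ hJ₂ hJW
      hs hs₁ hs₂ hc hc₁ hc₂)

/-- **the renormalised second small pair splitting `pairSmallLeft₂ s₂ ⊗ c₂` is continuous.**
[cite: Weil1964, Chap. III n° 39 p. 189] -/
theorem continuous_twist_pairSmallLeft₂
    (hc : Continuous (pairSplitting F E c (N₁ + N₂) M eV (finSum N₁ N₂ J₁ J₂) JW s))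
    (hc₁ : Continuous (pairSplitting F E c N₁ M e₁ J₁ JW s₁)) (hc₂ : Continuous (pairSplitting F E c N₂ M e₂ J₂ JW s₂)) :
    Continuous (adelicMpCont.twist F (Fin N₂ × Fin M)
      (T₂.map (algebraMap F (AdeleRing (𝓞 F) F)) ⊗ₖ TW.map (algebraMap F (AdeleRing (𝓞 F) F)))
      (pairSmallLeft₂ F E c N₂ M e₂ J₂ JW s₂)
      (mpCharSmall₂ (seesawBigLeftSum F E c N₁ N₂ M eV J₁ J₂ JW s) (pairSmallLeft₁ F E c N₁ M e₁ J₁ JW s₁)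
        (pairSmallLeft₂ F E c N₂ M e₂ J₂ JW s₂)
        (hs₃_seesawLeft F E c N₁ N₂ M eV e₁ e₂ J₁ J₂ JW hcδ hδ hd h₁ h₂ hW h₁d h₂d hWd hVd hJ₁ hJ₂ hJW hs hs₁ hs₂)
        (isUnit_kronecker_map F N₁ h₁d hWd) (isUnit_kronecker_map F N₂ h₂d hWd))) :=
  adelicMpCont.continuous_twist _ _ (continuous_pairSmallLeft₂ F E c N₂ M e₂ J₂ JW hc₂)
    (continuous_mpCharSmall₂_seesawLeft F E c N₁ N₂ M eV e₁ e₂ J₁ J₂ JW hcδ hδ hd h₁ h₂ hW h₁d h₂d hWd hVd hJ₁ hJ₂ hJW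
      hs hs₁ hs₂ hc hc₁ hc₂)

end ContinuityTwist

end UnitaryDualPair

end Literature.NumberTheory.GelbartRogawski1991

end
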